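/-
HONEST FRAMING: systematic search; no irrationality claim unless certified.
-/
import Summits.KontsevichZagierPeriods.Zeta5Search.WedgeDictionaryCertKitFamily
import Summits.KontsevichZagierPeriods.Zeta5Search.WedgeDictionaryAssemblyGlue
import HarnessLib

/-!
# Certificate kit, part 3: placements along two-parameter families (the `S₇` glue in numeral form)

HONEST FRAMING: systematic search; no irrationality claim unless certified.
OUR work (Summit side; cell `pub-zeta5`, planner gen-1 g18, 2026-08-21; memo `pub-zeta5-gen-1/D2-TERMINAL-g17.md` §2d).

Continuation of `WedgeDictionaryCertKit` / `WedgeDictionaryCertKitFamily`: the five generators `p₀₁, p₁₂, h, h', i₁` of the group `G` are LINEAR on the parameter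
vectors, hence map an affine family `pt v u w m t` onto the family `pt (g v) (g u) (g w) m t`; the tree's pull-back lemmas
`explicitPQAt_pull_gen*` (`WedgeDictionaryAssemblyGlue`, modulo the cited invariance (27)) then take ONE decidable hypothesis
(images of `v, u, w` and the region data of both families) — `pullP01`, …, `pullI1`.  `apply_row` evaluates a row hypothesis at a
member of a family, `place` switches to the partner of an arbitrary region hypothesis, `bfacts` unfolds the region hypotheses into
linear arithmetic for `omega`, and `not_terminal7` excludes the all-non-zero pattern.  Elementary algebra only. [folklore]
-/

noncomputable section

open Finset

namespace Summit.KontsevichZagierPeriods.Zeta5Search.WedgeDictionary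

open Summit.KontsevichZagierPeriods.Zeta5Search.DualSeries
open Literature.NumberTheory.Irrationality.BrownZudilin2022
open Literature.NumberTheory.Transcendental (zetaValue)

namespace CertKit

/-! ## 8. The generators are linear: images of families are families -/

/-- `p₀₁` along a family. [folklore] -/
theorem genP01_pt {v u w v' u' w' : Vec} (h : genP01 v = v' ∧ genP01 u = u' ∧ genP01 w = w') (m t : ℕ) :
    genP01 (pt v u w m t) = pt v' u' w' m t := by
  obtain ⟨rfl, rfl, rfl⟩ := h
  ext n; fin_cases n <;> simp [genP01, pt] <;> ring

/-- `p₁₂` along a family. [folklore] -/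
theorem genP12_pt {v u w v' u' w' : Vec} (h : genP12 v = v' ∧ genP12 u = u' ∧ genP12 w = w') (m t : ℕ) :
    genP12 (pt v u w m t) = pt v' u' w' m t := by
  obtain ⟨rfl, rfl, rfl⟩ := h
  ext n; fin_cases n <;> simp [genP12, pt] <;> ring

/-- `h` along a family. [folklore] -/
theorem genH_pt {v u w v' u' w' : Vec} (h : genH v = v' ∧ genH u = u' ∧ genH w = w') (m t : ℕ) :
    genH (pt v u w m t) = pt v' u' w' m t := by
  obtain ⟨rfl, rfl, rfl⟩ := h
  ext n; fin_cases n <;> simp [genH, pt] <;> ring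

/-- `h'` along a family. [folklore] -/
theorem genHp_pt {v u w v' u' w' : Vec} (h : genH' v = v' ∧ genH' u = u' ∧ genH' w = w') (m t : ℕ) :
    genH' (pt v u w m t) = pt v' u' w' m t := by
  obtain ⟨rfl, rfl, rfl⟩ := h
  ext n; fin_cases n <;> simp [genH', pt] <;> ring

/-- `i₁` along a family. [folklore] -/
theorem genI1_pt {v u w v' u' w' : Vec} (h : genI1 v = v' ∧ genI1 u = u' ∧ genI1 w = w') (m t : ℕ) :
    genI1 (pt v u w m t) = pt v' u' w' m t := by
  obtain ⟨rfl, rfl, rfl⟩ := h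
  ext n; fin_cases n <;> simp [genI1, pt]
  ring

/-! ## 9. Pull-backs along the generators, family form (one decidable hypothesis each) -/

/-- **Pull-back along `p₀₁`, family form.** [folklore] -/
theorem pullP01 (hInv : invariance_of_converges') (u w : Vec) (m t : ℕ) (v v' u' w' : Vec) (j j' : ℕ)
    (h : (genP01 v = v' ∧ genP01 u = u' ∧ genP01 w = w') ∧ RegionData v u w j ∧ RegionData v' u' w' j')
    (hE : ExplicitPQAt (pt v' u' w' m t) j') : ExplicitPQAt (pt v u w m t) j := by
  obtain ⟨hg, hr, hr'⟩ := h
  have e := genP01_pt hg m t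
  refine explicitPQAt_pull_genP01 hInv (j := j') (region_pt hr m t) ?_ ?_
  · rw [e]; exact region_pt hr' m t
  · rw [e]; exact hE

/-- **Pull-back along `p₁₂`, family form.** [folklore] -/
theorem pullP12 (hInv : invariance_of_converges') (u w : Vec) (m t : ℕ) (v v' u' w' : Vec) (j j' : ℕ)
    (h : (genP12 v = v' ∧ genP12 u = u' ∧ genP12 w = w') ∧ RegionData v u w j ∧ RegionData v' u' w' j')
    (hE : ExplicitPQAt (pt v' u' w' m t) j') : ExplicitPQAt (pt v u w m t) j := by
  obtain ⟨hg, hr, hr'⟩ := h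
  have e := genP12_pt hg m t
  refine explicitPQAt_pull_genP12 hInv (j := j') (region_pt hr m t) ?_ ?_
  · rw [e]; exact region_pt hr' m t
  · rw [e]; exact hE

/-- **Pull-back along `h`, family form.** [folklore] -/
theorem pullH (hInv : invariance_of_converges') (u w : Vec) (m t : ℕ) (v v' u' w' : Vec) (j j' : ℕ)
    (h : (genH v = v' ∧ genH u = u' ∧ genH w = w') ∧ RegionData v u w j ∧ RegionData v' u' w' j')
    (hE : ExplicitPQAt (pt v' u' w' m t) j') : ExplicitPQAt (pt v u w m t) j := by
  obtain ⟨hg, hr, hr'⟩ := h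
  have e := genH_pt hg m t
  refine explicitPQAt_pull_genH hInv (j := j') (region_pt hr m t) ?_ ?_
  · rw [e]; exact region_pt hr' m t
  · rw [e]; exact hE

/-- **Pull-back along `h'`, family form.** [folklore] -/
theorem pullHp (hInv : invariance_of_converges') (u w : Vec) (m t : ℕ) (v v' u' w' : Vec) (j j' : ℕ)
    (h : (genH' v = v' ∧ genH' u = u' ∧ genH' w = w') ∧ RegionData v u w j ∧ RegionData v' u' w' j')
    (hE : ExplicitPQAt (pt v' u' w' m t) j') : ExplicitPQAt (pt v u w m t) j := by
  obtain ⟨hg, hr, hr'⟩ := h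
  have e := genHp_pt hg m t
  refine explicitPQAt_pull_genHp hInv (j := j') (region_pt hr m t) ?_ ?_
  · rw [e]; exact region_pt hr' m t
  · rw [e]; exact hE

/-- **Pull-back along `i₁`, family form.** [folklore] -/
theorem pullI1 (hInv : invariance_of_converges') (u w : Vec) (m t : ℕ) (v v' u' w' : Vec) (j j' : ℕ)
    (h : (genI1 v = v' ∧ genI1 u = u' ∧ genI1 w = w') ∧ RegionData v u w j ∧ RegionData v' u' w' j')
    (hE : ExplicitPQAt (pt v' u' w' m t) j') : ExplicitPQAt (pt v u w m t) j := by
  obtain ⟨hg, hr, hr'⟩ := h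
  have e := genI1_pt hg m t
  refine explicitPQAt_pull_genI1 hInv (j := j') (region_pt hr m t) ?_ ?_
  · rw [e]; exact region_pt hr' m t
  · rw [e]; exact hE

/-! ## 10. Row hypotheses at members of a family; terminal bookkeeping -/

/-- **A row hypothesis evaluated at a member of a family**: the dual coordinates of `pt v u w m t` are read off the numeral data
of `(v, u, w)` (checked by `decide`), the eight pattern equations are linear arithmetic. [folklore] -/
theorem apply_row {c₀ c₁ c₂ c₃ c₄ c₅ c₆ c₇ : ℤ} {j : ℕ}
    (hrow : ∀ a' : Vec, bOfA a' 0 = c₀ → bOfA a' 1 = c₁ → bOfA a' 2 = c₂ → bOfA a' 3 = c₃ → bOfA a' 4 = c₄ →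
      bOfA a' 5 = c₅ → bOfA a' 6 = c₆ → bOfA a' 7 = c₇ → ExplicitPQAt a' j)
    (v u w : Vec) (m t : ℕ) (p₀ q₀ r₀ p₁ q₁ r₁ p₂ q₂ r₂ p₃ q₃ r₃ p₄ q₄ r₄ p₅ q₅ r₅ p₆ q₆ r₆ p₇ q₇ r₇ : ℤ)
    (hb : bAff v u w 0 = (p₀, q₀, r₀) ∧ bAff v u w 1 = (p₁, q₁, r₁) ∧ bAff v u w 2 = (p₂, q₂, r₂) ∧
      bAff v u w 3 = (p₃, q₃, r₃) ∧ bAff v u w 4 = (p₄, q₄, r₄) ∧ bAff v u w 5 = (p₅, q₅, r₅) ∧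
      bAff v u w 6 = (p₆, q₆, r₆) ∧ bAff v u w 7 = (p₇, q₇, r₇))
    (e0 : p₀ + q₀ * m + r₀ * t = c₀) (e1 : p₁ + q₁ * m + r₁ * t = c₁) (e2 : p₂ + q₂ * m + r₂ * t = c₂)
    (e3 : p₃ + q₃ * m + r₃ * t = c₃) (e4 : p₄ + q₄ * m + r₄ * t = c₄) (e5 : p₅ + q₅ * m + r₅ * t = c₅)
    (e6 : p₆ + q₆ * m + r₆ * t = c₆) (e7 : p₇ + q₇ * m + r₇ * t = c₇) : ExplicitPQAt (pt v u w m t) j := by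
  obtain ⟨b0, b1, b2, b3, b4, b5, b6, b7⟩ := hb
  refine hrow _ ?_ ?_ ?_ ?_ ?_ ?_ ?_ ?_
  · rw [bOfA_pt v u w m t 0 (by norm_num), b0]; exact e0
  · rw [bOfA_pt v u w m t 1 (by norm_num), b1]; exact e1
  · rw [bOfA_pt v u w m t 2 (by norm_num), b2]; exact e2
  · rw [bOfA_pt v u w m t 3 (by norm_num), b3]; exact e3
  · rw [bOfA_pt v u w m t 4 (by norm_num), b4]; exact e4
  · rw [bOfA_pt v u w m t 5 (by norm_num), b5]; exact e5
  · rw [bOfA_pt v u w m t 6 (by norm_num), b6]; exact e6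
  · rw [bOfA_pt v u w m t 7 (by norm_num), b7]; exact e7

/-- One dual coordinate of a member of a family, numeral form. [folklore] -/
theorem bval (v u w : Vec) (m t : ℕ) (n : ℕ) (p q r : ℤ) (h : n ≤ 7 ∧ bAff v u w n = (p, q, r)) :
    bOfA (pt v u w m t) n = p + q * m + r * t := by
  rw [bOfA_pt v u w m t n h.1, h.2]; rfl

/-- **Placement**: a point identified as a member of a family with decided region data (partner `j₀`) and `explicitPQ` there
satisfies `explicitPQ` for every admissible partner. [folklore] -/
theorem place {a : Vec} (v u w : Vec) (m t : ℕ) (j₀ : ℕ) (ha : a = pt v u w m t) (hreg : RegionData v u w j₀)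
    (h : ExplicitPQAt (pt v u w m t) j₀) {j : ℕ} (hr : RegionHyp a j) : ExplicitPQAt a j := by
  subst ha
  exact explicitPQAt_partner (region_pt hreg m t) hr h

/-- **The region hypotheses as linear arithmetic**: the dual coordinates in terms of `a`, the seventeen convergence forms, the box,
`d ≥ 0` and the partner condition (feed to `omega`). [folklore] -/
theorem bfacts {a : Vec} {j : ℕ} (hr : RegionHyp a j) :
    (bOfA a 0 = a 1 + a 2 + a 3 ∧ bOfA a 1 = -a 0 + a 2 + a 3 ∧ bOfA a 2 = a 1 ∧ bOfA a 3 = a 3 ∧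
      bOfA a 4 = a 1 + a 2 - a 4 ∧ bOfA a 5 = a 1 + a 2 - a 7 ∧ bOfA a 6 = a 3 - a 5 + a 7 ∧
      bOfA a 7 = a 1 + a 2 + a 5 - a 6 - a 7) ∧
    (0 ≤ a 0 ∧ 0 ≤ a 1 ∧ 0 ≤ a 2 ∧ 0 ≤ a 3 ∧ 0 ≤ a 4 ∧ 0 ≤ a 5 ∧ 0 ≤ a 6 ∧ 0 ≤ a 0 + a 4 - a 2 ∧
      0 ≤ a 2 + a 5 - a 7 ∧ 0 ≤ a 3 + a 4 + a 6 + a 7 - a 1 - a 2 - a 5 ∧ 0 ≤ a 6 + a 7 - a 5 ∧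
      0 ≤ a 3 + a 7 - a 1 ∧ 0 ≤ a 1 + a 2 + a 5 - a 3 - a 7 ∧ 0 ≤ a 0 + a 7 - a 2 ∧ 0 ≤ a 0 + a 1 - a 3 ∧
      0 ≤ a 3 + a 4 - a 1 ∧ 0 ≤ a 3 + a 6 + 2 * a 7 - a 1 - a 2 - a 5) ∧
    ((0 ≤ bOfA a 1 ∧ 2 * bOfA a 1 ≤ bOfA a 0 + 1) ∧ (0 ≤ bOfA a 2 ∧ 2 * bOfA a 2 ≤ bOfA a 0 + 1) ∧
      (0 ≤ bOfA a 3 ∧ 2 * bOfA a 3 ≤ bOfA a 0 + 1) ∧ (0 ≤ bOfA a 4 ∧ 2 * bOfA a 4 ≤ bOfA a 0 + 1) ∧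
      (0 ≤ bOfA a 5 ∧ 2 * bOfA a 5 ≤ bOfA a 0 + 1) ∧ (0 ≤ bOfA a 6 ∧ 2 * bOfA a 6 ≤ bOfA a 0 + 1) ∧
      (0 ≤ bOfA a 7 ∧ 2 * bOfA a 7 ≤ bOfA a 0 + 1)) ∧
    0 ≤ a 0 + a 4 + a 6 + a 7 - a 1 - a 2 ∧ 2 * (bOfA a j + 1) ≤ bOfA a 0 + 1 := by
  obtain ⟨-, hc, hbox, hd, hp⟩ := hr
  rw [forall_Icc17] at hbox
  rw [dOf_bOfA] at hd
  simp only [Converges, convergenceForms, List.forall_mem_cons, List.not_mem_nil, false_implies, implies_true,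
    and_true] at hc
  exact ⟨⟨rfl, rfl, rfl, rfl, rfl, rfl, rfl, rfl⟩, hc, hbox, hd, hp⟩

/-- The all-non-zero pattern is not terminal. [folklore] -/
theorem not_terminal7 {a : Vec} {i : ℕ} (hi : i ∈ Icc 1 7) (hz : bOfA a i = 0) (z1 : bOfA a 1 ≠ 0) (z2 : bOfA a 2 ≠ 0)
    (z3 : bOfA a 3 ≠ 0) (z4 : bOfA a 4 ≠ 0) (z5 : bOfA a 5 ≠ 0) (z6 : bOfA a 6 ≠ 0) (z7 : bOfA a 7 ≠ 0) : False := by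
  rw [mem_Icc] at hi
  obtain ⟨h1, h7⟩ := hi
  interval_cases i <;> omega

/-- The induction hypothesis relative to a lower level. [folklore] -/
theorem ih_mono {N N' : ℤ} (hle : N' ≤ N) (IH : ∀ (c : Vec) (j : ℕ), bOfA c 0 < N → RegionHyp c j → ExplicitPQAt c j) :
    ∀ (c : Vec) (j : ℕ), bOfA c 0 < N' → RegionHyp c j → ExplicitPQAt c j :=
  fun c j hc hrc => IH c j (lt_of_lt_of_le hc hle) hrc

end CertKit

end Summit.KontsevichZagierPeriods.Zeta5Search.WedgeDictionary

end
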